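import Literature.Geometry.DiscreteGeometry.ShellQuadCert
import Literature.Geometry.DiscreteGeometry.ShellCensusTwelve
import Literature.Analysis.FluidPDE.TaoAveragedAngleSynthesis
import Mathlib.Analysis.SpecialFunctions.Trigonometric.Bounds
import HarnessLib

/-!
# The fcc / hcp twelve-shells as `QuadCert` problems: specifications and the closeness theorem from a certificate

Topic `Literature/Geometry/DiscreteGeometry`.  The instance layer of `ShellQuadCert.lean` for the two LABELLED
kissing shells of close packing at bond/radius tolerance `1/50`, far gap `63/50`, closeness `1/5`
(`Literature.Geometry.DiscreteGeometry.ShellCensus.fccTuple` / `hcpTuple`, anchors `fccAnchors` / `hcpAnchors`):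

* `fccQSpec`, `hcpQSpec : ShellQuadCert.ShellSpec` — the labelled bond and far pairs of `fccVec` / `hcpVec` (explicit
  lists, checked against `sqNormInt` by `decide`), the frame on a bonded triangle (`0, 4, 8` resp. `6, 7, 8`), and
  DYADIC window constants `rloD ≤ 49/50`, `51/50 ≤ rhiD`, `gapD ≤ 63/50` (certificate texts carry dyadic rationals
  only; weakening the windows by `< 2⁻³⁰` costs nothing);
* `hyp_of_labelled`: a labelled tolerant realization, moved into the frame of `ShellCensus.exists_frame`,
  satisfies `ShellSpec.Hyp`;
* **`tupleClose_of_hyp`**, **`tupleClose_fcc_of_certified`**, **`tupleClose_hcp_of_certified`**: if the root context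
  of either specification is `QuadCert.Certified` for the dyadic
  goal reading `DGoal.gp` — i.e. SOME accepted `QuadCert` tree / forest proves, on every branch, the goal facts
  `θ² − ‖ω‖² ≥ 0`, `cst − ‖x_k − q_k − ω × q_k‖² ≥ 0` — and small rotations exist with the Rodrigues remainder
  (`SmallRotations`, `smallRotations_holds`), then every labelled tolerant realization is
  `TupleClose (1/5)` to the pattern [cite: MusinTarasov2012, §4] (model: graph fixed, positions certified).

No certificate is asserted to exist here; the computational content lands separately (`native_decide` run files).

## References
* O. R. Musin, A. S. Tarasov, DCG 48 (2012), §4. [cite: MusinTarasov2012, §4]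
* T. C. Hales, *Dense Sphere Packings* (2012), §1.3 (the fcc and hcp patterns). [cite: HalesDSP2012, §1.3]
-/

noncomputable section

namespace Literature.Geometry.DiscreteGeometry

open Literature.Analysis.ValidatedNumerics Literature.Analysis.ValidatedNumerics.QPoly
  Literature.Analysis.ValidatedNumerics.QuadCert ShellCensus ShellQuadCert

/-- Euclidean `3`-space. -/
local notation "E3" => EuclideanSpace ℝ (Fin 3)

namespace ShellQuadCertTwelve

/-! ### Dyadic windows -/

/-- Dyadic lower window end `⌊0.98 · 2³⁰⌋ / 2³⁰ ≤ 49/50`. [folklore] -/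
def rloD : ℚ := 1052266987 / 2 ^ 30
/-- Dyadic upper window end `⌈1.02 · 2³⁰⌉ / 2³⁰ ≥ 51/50`. [folklore] -/
def rhiD : ℚ := 1095216661 / 2 ^ 30
/-- Dyadic gap `⌊1.26 · 2³⁰⌋ / 2³⁰ ≤ 63/50`. [folklore] -/
def gapD : ℚ := 1352914698 / 2 ^ 30

/-- The dyadic windows are weaker than the true ones. [folklore] -/
theorem windows_weaken : rloD ≤ 49 / 50 ∧ (51 : ℚ) / 50 ≤ rhiD ∧ gapD ≤ 63 / 50 ∧ 0 ≤ rloD ∧ 0 ≤ gapD := by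
  refine ⟨?_, ?_, ?_, ?_, ?_⟩ <;> norm_num [rloD, rhiD, gapD]

/-! ### The two specifications -/

/-- Labelled bonds of `fccVec` (pairs `k < l` with `sqNormInt (fccVec k − fccVec l) = 2`). [cite: HalesDSP2012, §1.3] -/
def fccBonds : List (ℕ × ℕ) :=
  [(0, 4), (0, 5), (0, 8), (0, 9), (1, 4), (1, 5), (1, 10), (1, 11), (2, 6), (2, 7), (2, 8), (2, 9), (3, 6), (3, 7),
    (3, 10), (3, 11), (4, 8), (4, 10), (5, 9), (5, 11), (6, 8), (6, 10), (7, 9), (7, 11)]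

/-- Labelled far pairs of `fccVec` (the other pairs `k < l`). [cite: HalesDSP2012, §1.3] -/
def fccFars : List (ℕ × ℕ) :=
  [(0, 1), (0, 2), (0, 3), (0, 6), (0, 7), (0, 10), (0, 11), (1, 2), (1, 3), (1, 6), (1, 7), (1, 8), (1, 9), (2, 3),
    (2, 4), (2, 5), (2, 10), (2, 11), (3, 4), (3, 5), (3, 8), (3, 9), (4, 5), (4, 6), (4, 7), (4, 9), (4, 11), (5, 6),
    (5, 7), (5, 8), (5, 10), (6, 7), (6, 9), (6, 11), (7, 8), (7, 10), (8, 9), (8, 10), (8, 11), (9, 10), (9, 11),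
    (10, 11)]

/-- Labelled bonds of `hcpVec` (pairs `k < l` with `sqNormInt (hcpVec k − hcpVec l) = 18`). [cite: HalesDSP2012, §1.3] -/
def hcpBonds : List (ℕ × ℕ) :=
  [(0, 2), (0, 5), (0, 7), (0, 10), (1, 3), (1, 4), (1, 8), (1, 11), (2, 4), (2, 6), (2, 9), (3, 5), (3, 8), (3, 11),
    (4, 6), (4, 9), (5, 7), (5, 10), (6, 7), (6, 8), (7, 8), (9, 10), (9, 11), (10, 11)]

/-- Labelled far pairs of `hcpVec`. [cite: HalesDSP2012, §1.3] -/
def hcpFars : List (ℕ × ℕ) :=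
  [(0, 1), (0, 3), (0, 4), (0, 6), (0, 8), (0, 9), (0, 11), (1, 2), (1, 5), (1, 6), (1, 7), (1, 9), (1, 10), (2, 3),
    (2, 5), (2, 7), (2, 8), (2, 10), (2, 11), (3, 4), (3, 6), (3, 7), (3, 9), (3, 10), (4, 5), (4, 7), (4, 8), (4, 10),
    (4, 11), (5, 6), (5, 8), (5, 9), (5, 11), (6, 9), (6, 10), (6, 11), (7, 9), (7, 10), (7, 11), (8, 9), (8, 10),
    (8, 11)]

/-- **The fcc twelve-shell specification** (frame on the bonded triangle `0, 4, 8`). [cite: HalesDSP2012, §1.3] -/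
def fccQSpec : ShellSpec where
  n := 12
  rlo := rloD
  rhi := rhiD
  gap := gapD
  bonds := fccBonds
  fars := fccFars
  i0 := 0
  i1 := 4
  i2 := 8
  anchors := fccAnchors
  aeps := 1 / 10 ^ 6
  eta := 1 / 5

/-- **The hcp twelve-shell specification** (frame on the bonded triangle `6, 7, 8`). [cite: HalesDSP2012, §1.3] -/
def hcpQSpec : ShellSpec where
  n := 12
  rlo := rloD
  rhi := rhiD
  gap := gapD
  bonds := hcpBonds
  fars := hcpFars
  i0 := 6
  i1 := 7
  i2 := 8
  anchors := hcpAnchors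
  aeps := 1 / 10 ^ 6
  eta := 1 / 5

/-- Index sanity of both specifications. [folklore] -/
theorem okB_specs : fccQSpec.okB = true ∧ hcpQSpec.okB = true := by
  constructor <;> decide +kernel

/-- The bond lists are exactly the labelled bonds, the far lists exactly the labelled non-bonds (pairs `k < l`). [folklore] -/
theorem lists_correct :
    (∀ kl ∈ fccBonds, ∃ (hk : kl.1 < 12) (hl : kl.2 < 12), kl.1 ≠ kl.2 ∧
        sqNormInt (fccVec ⟨kl.1, hk⟩ - fccVec ⟨kl.2, hl⟩) = 2) ∧
    (∀ kl ∈ fccFars, ∃ (hk : kl.1 < 12) (hl : kl.2 < 12), kl.1 ≠ kl.2 ∧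
        sqNormInt (fccVec ⟨kl.1, hk⟩ - fccVec ⟨kl.2, hl⟩) ≠ 2) ∧
    (∀ kl ∈ hcpBonds, ∃ (hk : kl.1 < 12) (hl : kl.2 < 12), kl.1 ≠ kl.2 ∧
        sqNormInt (hcpVec ⟨kl.1, hk⟩ - hcpVec ⟨kl.2, hl⟩) = 18) ∧
    (∀ kl ∈ hcpFars, ∃ (hk : kl.1 < 12) (hl : kl.2 < 12), kl.1 ≠ kl.2 ∧
        sqNormInt (hcpVec ⟨kl.1, hk⟩ - hcpVec ⟨kl.2, hl⟩) ≠ 18) := by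
  refine ⟨?_, ?_, ?_, ?_⟩ <;> decide

/-! ### The hypotheses of a labelled tolerant realization give `Hyp` in the frame -/

/-- Generic: a labelled realization (norms and bonds in `[49/50, 51/50]`, non-bonds `≥ 63/50`, bond iff the
integer pattern vectors are at squared distance `B`) satisfies `Hyp` for a specification with the dyadic windows,
whose lists are correct for that pattern, once it is in the frame. [folklore] -/
theorem hyp_of_labelled (P : ShellSpec) (V : Fin P.n → Fin 3 → ℤ) (B : ℤ)
    (hr : P.rlo = rloD ∧ P.rhi = rhiD ∧ P.gap = gapD)
    (hbond : ∀ kl ∈ P.bonds, ∃ (hk : kl.1 < P.n) (hl : kl.2 < P.n), kl.1 ≠ kl.2 ∧ sqNormInt (V ⟨kl.1, hk⟩ - V ⟨kl.2, hl⟩) = B)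
    (hfar : ∀ kl ∈ P.fars, ∃ (hk : kl.1 < P.n) (hl : kl.2 < P.n), kl.1 ≠ kl.2 ∧ sqNormInt (V ⟨kl.1, hk⟩ - V ⟨kl.2, hl⟩) ≠ B)
    (t : Fin P.n → E3)
    (hn : ∀ k, 1 - 1 / 50 ≤ ‖t k‖ ∧ ‖t k‖ ≤ 1 + 1 / 50)
    (hd : ∀ k l, k ≠ l → 1 - 1 / 50 ≤ dist (t k) (t l) ∧ (dist (t k) (t l) ≤ 1 + 1 / 50 ∨ 63 / 50 ≤ dist (t k) (t l)))
    (hG : ∀ k l, k ≠ l → (dist (t k) (t l) ≤ 1 + 1 / 50 ↔ sqNormInt (V k - V l) = B))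
    (hf0 : ∀ h : P.i0 < P.n, t ⟨P.i0, h⟩ 0 = 0 ∧ t ⟨P.i0, h⟩ 1 = 0 ∧ 0 ≤ t ⟨P.i0, h⟩ 2)
    (hf1 : ∀ h : P.i1 < P.n, t ⟨P.i1, h⟩ 1 = 0 ∧ 0 ≤ t ⟨P.i1, h⟩ 0)
    (hf2 : ∀ h : P.i2 < P.n, 0 ≤ t ⟨P.i2, h⟩ 1) : P.Hyp t := by
  obtain ⟨hrlo, hrhi, hgap⟩ := hr
  have w1' : ((P.rlo : ℚ) : ℝ) ≤ 1 - 1 / 50 := by rw [hrlo, rloD]; norm_num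
  have w2' : (1 : ℝ) + 1 / 50 ≤ P.rhi := by rw [hrhi, rhiD]; norm_num
  have w3' : ((P.gap : ℚ) : ℝ) ≤ 63 / 50 := by rw [hgap, gapD]; norm_num
  refine ⟨fun k => ⟨w1'.trans (hn k).1, (hn k).2.trans w2'⟩, fun kl hkl hk hl => ?_, fun kl hkl hk hl => ?_,
    hf0, hf1, hf2⟩
  · obtain ⟨hk', hl', hne, hB⟩ := hbond kl hkl
    have hne' : (⟨kl.1, hk⟩ : Fin P.n) ≠ ⟨kl.2, hl⟩ := fun h => hne (by simpa using congrArg Fin.val h)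
    obtain ⟨hlo, _⟩ := hd _ _ hne'
    have hle : dist (t ⟨kl.1, hk⟩) (t ⟨kl.2, hl⟩) ≤ 1 + 1 / 50 := (hG _ _ hne').2 hB
    exact ⟨w1'.trans hlo, hle.trans w2'⟩
  · obtain ⟨hk', hl', hne, hB⟩ := hfar kl hkl
    have hne' : (⟨kl.1, hk⟩ : Fin P.n) ≠ ⟨kl.2, hl⟩ := fun h => hne (by simpa using congrArg Fin.val h)
    obtain ⟨_, hor⟩ := hd _ _ hne'
    have hnot : ¬ dist (t ⟨kl.1, hk⟩) (t ⟨kl.2, hl⟩) ≤ 1 + 1 / 50 := by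
      intro h
      exact hB ((hG _ _ hne').1 h)
    rcases hor with h | h
    · exact absurd h hnot
    · exact w3'.trans h

/-- The anchors of the two specifications, pointwise. [folklore] -/
theorem anchor_specs (k : Fin 12) :
    fccQSpec.anchor k = scaleAnchor (70710678 / 10 ^ 8) (fccVec k) ∧
      hcpQSpec.anchor k = scaleAnchor (2357022604 / 10 ^ 10) (hcpVec k) := by
  fin_cases k <;> exact ⟨rfl, rfl⟩

/-! ### Closeness from a certificate -/

/-- Small rotations with the Rodrigues remainder: for every `ω` an exact linear isometry `S` with
`‖S X − X − ω × X‖ ≤ (‖ω‖²/2 + ‖ω‖³/4)‖X‖`. [folklore] -/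
def SmallRotations : Prop :=
  ∀ ω : E3, ∃ S : E3 ≃ₗᵢ[ℝ] E3, ∀ X, ‖S X - X - Literature.Analysis.FluidPDE.cross ω X‖ ≤ (‖ω‖ ^ 2 / 2 + ‖ω‖ ^ 3 / 4) * ‖X‖

section SmallRot

open scoped RealInnerProductSpace
open Literature.Analysis.FluidPDE Literature.Analysis.FluidPDE.Tao2016

/-- `|cos θ − 1| ≤ θ²/2`. [folklore] -/
theorem abs_cos_sub_one_le (θ : ℝ) : |Real.cos θ - 1| ≤ θ ^ 2 / 2 := by
  rw [abs_le]
  refine ⟨by linarith [Real.one_sub_sq_div_two_le_cos (x := θ)], ?_⟩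
  linarith [Real.cos_le_one θ, sq_nonneg θ]

/-- `|sin θ − θ| ≤ θ³/6` for `θ ≥ 0`. [folklore] -/
theorem abs_sin_sub_self_le {θ : ℝ} (hθ : 0 ≤ θ) : |Real.sin θ - θ| ≤ θ ^ 3 / 6 := by
  rw [abs_sub_comm]
  simpa [abs_of_nonneg hθ] using Real.abs_sub_sin_le θ

/-- For a unit vector `u`: `‖X − ⟪X, u⟫ u‖ ≤ ‖X‖`. [folklore] -/
theorem norm_sub_proj_le {u : E3} (hu : ‖u‖ = 1) (X : E3) : ‖X - ⟪X, u⟫ • u‖ ≤ ‖X‖ := by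
  have h : ‖X - ⟪X, u⟫ • u‖ ^ 2 = ‖X‖ ^ 2 - ⟪X, u⟫ ^ 2 := by
    rw [norm_sub_sq_real, real_inner_smul_right, norm_smul, Real.norm_eq_abs, hu, mul_one, sq_abs]
    ring
  have h2 : ‖X - ⟪X, u⟫ • u‖ ^ 2 ≤ ‖X‖ ^ 2 := by rw [h]; linarith [sq_nonneg ⟪X, u⟫]
  exact (sq_le_sq₀ (norm_nonneg _) (norm_nonneg _)).1 h2

/-- For a unit vector `u`: `‖u × X‖ ≤ ‖X‖`. [folklore] -/
theorem norm_cross_unit_le {u : E3} (hu : ‖u‖ = 1) (X : E3) : ‖cross u X‖ ≤ ‖X‖ := by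
  have h2 : ‖cross u X‖ ^ 2 ≤ ‖X‖ ^ 2 := by
    rw [norm_cross_sq, hu]; linarith [sq_nonneg ⟪u, X⟫]
  exact (sq_le_sq₀ (norm_nonneg _) (norm_nonneg _)).1 h2

/-- **Small rotations exist** (Rodrigues' rotation by the angle `‖ω‖` about `ω`; the same proof as
`Summit.AtomisticToContinuum.Crystallization.Theorems.stub_smallRot`, repeated here because Literature files do not
import summit files). [folklore] -/
theorem smallRotations_holds : SmallRotations := by
  intro ω
  by_cases hω : ω = 0
  · refine ⟨LinearIsometryEquiv.refl ℝ _, fun X => ?_⟩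
    have h0 : cross (0 : E3) X = 0 := by simpa using cross_smul_left 0 (0 : E3) X
    simp [hω, h0]
  · refine ⟨rodRotEquiv hω ‖ω‖, fun X => ?_⟩
    rw [rodRotEquiv_apply]
    have hθ : 0 ≤ ‖ω‖ := norm_nonneg ω
    have hu1 : ‖udir ω‖ = 1 := norm_udir hω
    have hωu : ω = ‖ω‖ • udir ω := by
      rw [udir, smul_smul, mul_inv_cancel₀ (norm_ne_zero_iff.mpr hω), one_smul]
    have hcr : cross ω X = ‖ω‖ • cross (udir ω) X := by
      conv_lhs => rw [hωu]
      rw [cross_smul_left]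
    have key : rodRot ω ‖ω‖ X - X - cross ω X =
        (Real.cos ‖ω‖ - 1) • (X - ⟪X, udir ω⟫ • udir ω) + (Real.sin ‖ω‖ - ‖ω‖) • cross (udir ω) X := by
      rw [hcr, rodRot]
      module
    have hP := norm_sub_proj_le hu1 X
    have hC := norm_cross_unit_le hu1 X
    have hX : 0 ≤ ‖X‖ := norm_nonneg X
    calc ‖rodRot ω ‖ω‖ X - X - cross ω X‖
        = ‖(Real.cos ‖ω‖ - 1) • (X - ⟪X, udir ω⟫ • udir ω) + (Real.sin ‖ω‖ - ‖ω‖) • cross (udir ω) X‖ := by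
          rw [key]
      _ ≤ ‖(Real.cos ‖ω‖ - 1) • (X - ⟪X, udir ω⟫ • udir ω)‖ + ‖(Real.sin ‖ω‖ - ‖ω‖) • cross (udir ω) X‖ :=
          norm_add_le _ _
      _ = |Real.cos ‖ω‖ - 1| * ‖X - ⟪X, udir ω⟫ • udir ω‖ + |Real.sin ‖ω‖ - ‖ω‖| * ‖cross (udir ω) X‖ := by
          rw [norm_smul, norm_smul, Real.norm_eq_abs, Real.norm_eq_abs]
      _ ≤ ‖ω‖ ^ 2 / 2 * ‖X‖ + ‖ω‖ ^ 3 / 6 * ‖X‖ := by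
          gcongr
          · exact abs_cos_sub_one_le ‖ω‖
          · exact abs_sin_sub_self_le hθ
      _ ≤ (‖ω‖ ^ 2 / 2 + ‖ω‖ ^ 3 / 4) * ‖X‖ := by nlinarith [pow_nonneg hθ 3]

end SmallRot

/-- **Closeness from a certificate (generic).**  For a specification `P` with `n = 12` whose root context is
`Certified` for the dyadic goal reading, every tuple `t` satisfying `Hyp` is `TupleClose P.eta` to any pattern `p` with
unit norms that the anchors approximate to within `aeps`. [cite: MusinTarasov2012, §4] -/
theorem tupleClose_of_hyp (hrot : SmallRotations) (P : ShellSpec) (hP : P.okB = true)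
    (hC : Certified (DGoal.gp P) P.rootCtx) (p : Fin P.n → E3) (hp1 : ∀ k, ‖p k‖ = 1)
    (hpa : ∀ k : Fin P.n, dist (p k) (qpt (P.anchor k)) ≤ P.aeps)
    (t : Fin P.n → E3) (H : P.Hyp t) : TupleClose (P.eta : ℝ) t p := by
  obtain ⟨g, qs, hgp, hqs⟩ := hC (flat t) (P.rootCtx_holds hP H)
  obtain ⟨hok, hθ, hdisp, hq⟩ := g.goal_sound P hgp t hqs
  have hok' := hok
  simp only [DGoal.ok, Bool.and_eq_true, decide_eq_true_eq] at hok'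
  obtain ⟨⟨⟨⟨⟨⟨⟨⟨⟨⟨-, -⟩, hM⟩, -⟩, hqe⟩, hth⟩, -⟩, -⟩, heps⟩, hbud⟩, -⟩ := hok'
  set ω := g.omV (flat t) with hω
  obtain ⟨S, hS⟩ := hrot ω
  set R := rotIso g.M hM with hR
  refine ⟨S.toLinearIsometry.comp R, Equiv.refl _, fun k => ?_⟩
  simp only [LinearIsometry.coe_comp, Function.comp_apply, Equiv.refl_apply, LinearIsometryEquiv.coe_toLinearIsometry]
  -- the placed anchor and the exact image of the anchor
  have hRa : R (qpt (P.anchor k)) = qpt (rotQ g.M (P.anchor k)) := by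
    rw [hR, rotIso_apply, rotLin_qpt]
  have hqa : dist (qpt (g.q k)) (R (qpt (P.anchor k))) ≤ g.qeps := by rw [hRa]; exact hq k
  have hap : dist (R (qpt (P.anchor k))) (R (p k)) ≤ P.aeps := by
    rw [LinearIsometry.dist_map, dist_comm]; exact hpa k
  -- norm of the placed anchor
  have hqn : ‖qpt (g.q k)‖ ≤ 1 + P.aeps + g.qeps := by
    have h1 : ‖qpt (g.q k)‖ ≤ ‖R (p k)‖ + dist (qpt (g.q k)) (R (p k)) := by
      have := norm_le_norm_add_norm_sub' (qpt (g.q k)) (R (p k))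
      rwa [← dist_eq_norm] at this
    have h2 : dist (qpt (g.q k)) (R (p k)) ≤ g.qeps + P.aeps :=
      (dist_triangle _ (R (qpt (P.anchor k))) _).trans (add_le_add hqa hap)
    rw [LinearIsometry.norm_map, hp1] at h1
    linarith
  -- Rodrigues remainder
  have hθ0 : 0 ≤ ‖ω‖ := norm_nonneg _
  have hth' : (0 : ℝ) ≤ g.theta := by exact_mod_cast hth
  have hrod : ‖S (qpt (g.q k)) - qpt (g.q k) - Literature.Analysis.FluidPDE.cross ω (qpt (g.q k))‖ ≤ g.eps := by
    refine (hS _).trans ?_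
    have hθ' : ‖ω‖ ^ 2 / 2 + ‖ω‖ ^ 3 / 4 ≤ (g.theta : ℝ) ^ 2 / 2 + (g.theta : ℝ) ^ 3 / 4 := by gcongr
    have h0 : (0 : ℝ) ≤ ‖ω‖ ^ 2 / 2 + ‖ω‖ ^ 3 / 4 := by positivity
    have hae : (0 : ℝ) ≤ 1 + P.aeps + g.qeps := by
      have := norm_nonneg (qpt (g.q k)); linarith
    have heps' : ((g.theta : ℝ) ^ 2 / 2 + (g.theta : ℝ) ^ 3 / 4) * (1 + P.aeps + g.qeps) ≤ g.eps := by
      exact_mod_cast heps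
    calc (‖ω‖ ^ 2 / 2 + ‖ω‖ ^ 3 / 4) * ‖qpt (g.q k)‖ ≤ (‖ω‖ ^ 2 / 2 + ‖ω‖ ^ 3 / 4) * (1 + P.aeps + g.qeps) := by
          gcongr
      _ ≤ ((g.theta : ℝ) ^ 2 / 2 + (g.theta : ℝ) ^ 3 / 4) * (1 + P.aeps + g.qeps) := by gcongr
      _ ≤ g.eps := heps'
  -- assemble
  have hbud' : (g.budget P : ℝ) = P.eta - g.eps - P.aeps - g.qeps := by simp [DGoal.budget]
  have h1 : dist (t k) (S (qpt (g.q k))) ≤ P.eta - P.aeps - g.qeps := by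
    rw [dist_eq_norm]
    have hd := hdisp k
    rw [hbud'] at hd
    calc ‖t k - S (qpt (g.q k))‖
        = ‖(t k - qpt (g.q k) - Literature.Analysis.FluidPDE.cross ω (qpt (g.q k))) -
            (S (qpt (g.q k)) - qpt (g.q k) - Literature.Analysis.FluidPDE.cross ω (qpt (g.q k)))‖ := by
          congr 1; abel
      _ ≤ ‖t k - qpt (g.q k) - Literature.Analysis.FluidPDE.cross ω (qpt (g.q k))‖ +
            ‖S (qpt (g.q k)) - qpt (g.q k) - Literature.Analysis.FluidPDE.cross ω (qpt (g.q k))‖ := norm_sub_le _ _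
      _ ≤ (P.eta - g.eps - P.aeps - g.qeps) + g.eps := add_le_add hd hrod
      _ = P.eta - P.aeps - g.qeps := by ring
  have h2 : dist (S (qpt (g.q k))) (S (R (p k))) ≤ g.qeps + P.aeps := by
    rw [LinearIsometryEquiv.dist_map]
    exact (dist_triangle _ (R (qpt (P.anchor k))) _).trans (add_le_add hqa hap)
  calc dist (t k) (S (R (p k))) ≤ dist (t k) (S (qpt (g.q k))) + dist (S (qpt (g.q k))) (S (R (p k))) :=
        dist_triangle _ _ _
    _ ≤ (P.eta - P.aeps - g.qeps) + (g.qeps + P.aeps) := add_le_add h1 h2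
    _ = P.eta := by ring

/-- **fcc: closeness from a certificate.**  If the fcc root context is certified, every labelled tolerant
realization of the cuboctahedral bond graph is `1/5`-close to `fccTuple` after a linear isometry. [cite: MusinTarasov2012, §4] -/
theorem tupleClose_fcc_of_certified (hC : Certified (DGoal.gp fccQSpec) fccQSpec.rootCtx)
    (t : Fin 12 → E3) (hn : ∀ k, 1 - 1 / 50 ≤ ‖t k‖ ∧ ‖t k‖ ≤ 1 + 1 / 50)
    (hd : ∀ k l, k ≠ l → 1 - 1 / 50 ≤ dist (t k) (t l) ∧ (dist (t k) (t l) ≤ 1 + 1 / 50 ∨ 63 / 50 ≤ dist (t k) (t l)))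
    (hG : ∀ k l, k ≠ l → (dist (t k) (t l) ≤ 1 + 1 / 50 ↔ sqNormInt (fccVec k - fccVec l) = 2)) :
    TupleClose (1 / 5) t fccTuple := by
  obtain ⟨A, h00, h01, h02, h11, h10, h21⟩ := exists_frame t (0 : Fin 12) 4 8
  refine TupleClose.of_isometry_comp A ?_
  have hP : fccQSpec.okB = true := okB_specs.1
  have heta : ((fccQSpec.eta : ℚ) : ℝ) = 1 / 5 := by norm_num [fccQSpec]
  rw [← heta]
  refine tupleClose_of_hyp smallRotations_holds fccQSpec hP hC (fccTuple ·) (fun k => ?_) (fun k => ?_) _ ?_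
  · exact norm_eq_one_of_mem_fccKissingPattern (by rw [← image_fccTuple]; exact Finset.mem_image_of_mem _ (Finset.mem_univ _))
  · rw [(anchor_specs k).1, show ((fccQSpec.aeps : ℚ) : ℝ) = 1 / 10 ^ 6 by norm_num [fccQSpec]]
    exact dist_fccTuple_anchor k
  · have e0 : ∀ h, (⟨fccQSpec.i0, h⟩ : Fin fccQSpec.n) = (0 : Fin 12) := fun _ => rfl
    have e1 : ∀ h, (⟨fccQSpec.i1, h⟩ : Fin fccQSpec.n) = (4 : Fin 12) := fun _ => rfl
    have e2 : ∀ h, (⟨fccQSpec.i2, h⟩ : Fin fccQSpec.n) = (8 : Fin 12) := fun _ => rfl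
    refine hyp_of_labelled fccQSpec fccVec 2 ⟨rfl, rfl, rfl⟩ lists_correct.1 lists_correct.2.1 _
      (fun k => ?_) (fun k l hkl => ?_) (fun k l hkl => ?_) (fun h => ?_) (fun h => ?_) (fun h => ?_)
    · simpa using hn k
    · simpa using hd k l hkl
    · simpa using hG k l hkl
    · rw [e0 h]; exact ⟨h00, h01, by rw [h02]; exact norm_nonneg _⟩
    · rw [e1 h]; exact ⟨h11, h10⟩
    · rw [e2 h]; exact h21

/-- **hcp: closeness from a certificate.**  If the hcp root context is certified, every labelled tolerant
realization of the anticuboctahedral bond graph is `1/5`-close to `hcpTuple` after a linear isometry. [cite: MusinTarasov2012, §4] -/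
theorem tupleClose_hcp_of_certified (hC : Certified (DGoal.gp hcpQSpec) hcpQSpec.rootCtx)
    (t : Fin 12 → E3) (hn : ∀ k, 1 - 1 / 50 ≤ ‖t k‖ ∧ ‖t k‖ ≤ 1 + 1 / 50)
    (hd : ∀ k l, k ≠ l → 1 - 1 / 50 ≤ dist (t k) (t l) ∧ (dist (t k) (t l) ≤ 1 + 1 / 50 ∨ 63 / 50 ≤ dist (t k) (t l)))
    (hG : ∀ k l, k ≠ l → (dist (t k) (t l) ≤ 1 + 1 / 50 ↔ sqNormInt (hcpVec k - hcpVec l) = 18)) :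
    TupleClose (1 / 5) t hcpTuple := by
  obtain ⟨A, h00, h01, h02, h11, h10, h21⟩ := exists_frame t (6 : Fin 12) 7 8
  refine TupleClose.of_isometry_comp A ?_
  have hP : hcpQSpec.okB = true := okB_specs.2
  have heta : ((hcpQSpec.eta : ℚ) : ℝ) = 1 / 5 := by norm_num [hcpQSpec]
  rw [← heta]
  refine tupleClose_of_hyp smallRotations_holds hcpQSpec hP hC (hcpTuple ·) (fun k => ?_) (fun k => ?_) _ ?_
  · exact norm_eq_one_of_mem_hcpKissingPattern (by rw [← image_hcpTuple]; exact Finset.mem_image_of_mem _ (Finset.mem_univ _))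
  · rw [(anchor_specs k).2, show ((hcpQSpec.aeps : ℚ) : ℝ) = 1 / 10 ^ 6 by norm_num [hcpQSpec]]
    exact dist_hcpTuple_anchor k
  · have e0 : ∀ h, (⟨hcpQSpec.i0, h⟩ : Fin hcpQSpec.n) = (6 : Fin 12) := fun _ => rfl
    have e1 : ∀ h, (⟨hcpQSpec.i1, h⟩ : Fin hcpQSpec.n) = (7 : Fin 12) := fun _ => rfl
    have e2 : ∀ h, (⟨hcpQSpec.i2, h⟩ : Fin hcpQSpec.n) = (8 : Fin 12) := fun _ => rfl
    refine hyp_of_labelled hcpQSpec hcpVec 18 ⟨rfl, rfl, rfl⟩ lists_correct.2.2.1 lists_correct.2.2.2 _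
      (fun k => ?_) (fun k l hkl => ?_) (fun k l hkl => ?_) (fun h => ?_) (fun h => ?_) (fun h => ?_)
    · simpa using hn k
    · simpa using hd k l hkl
    · simpa using hG k l hkl
    · rw [e0 h]; exact ⟨h00, h01, by rw [h02]; exact norm_nonneg _⟩
    · rw [e1 h]; exact ⟨h11, h10⟩
    · rw [e2 h]; exact h21

end ShellQuadCertTwelve

end Literature.Geometry.DiscreteGeometry

end
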